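import Mathlib
import HarnessLib

/-!
# Crux `PoloidalLiouville` (stmt-NavierStokesRegularity-1222, wall W1), crux idea «steady-centre-sieve» (ns-idea-15 g5):
# polynomial toolkit for the Euler-top algebra (A1 `EulerTopFirstIntegrals`, A2 `NoHarmonicPolhodeInvariant`)

Pure `MvPolynomial` lemmas, independent of the card's definitions (helper file, `--supports 1222`):

* §1 partial derivatives: `∂ᵢ` lowers a weighted degree by `w i`; in characteristic zero `∂₀ q = 0` iff `q` comes from
  `rename Fin.succ` (no `X 0`);
* §2 the parity grading of `ℝ[y₀,y₁,y₂]` by `(ZMod 2)³` (`wPar i = eᵢ`): the weight of a monomial is its exponent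
  vector mod 2; the even class is the range of `expand 2` (`y ↦ y²`); an odd class in the coordinate `i₀` is killed
  by any substitution with `yᵢ₀ ↦ 0`;
* §3 the linear chart `ψ : (v₀,v₁,v₂) ↦ (u₀, Σuᵢ, Σaᵢuᵢ)` of `ℝ[u₀,u₁,u₂]` as an explicit `AlgEquiv` (needs only
  `a₂ ≠ a₁`), the composite chart `Sq = expand 2 ∘ ψ` (`v ↦ (y₀², |y|², Σaᵢyᵢ²)`), and the left-inverse lemma
  `injective_of_pair` for the two-variable substitutions `(v₁,v₂) ↦ (u_j + u_k, a_j u_j + a_k u_k)`.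

Information-grade algebra; nothing here is about Navier–Stokes regularity (OPEN); `PoloidalLiouville` (1222) OPEN.
ns-wall-eng-5 g5 (cell ns-wall-extremal), 0 kit.
-/

-- the summit and its single sub-problem share the name (CONVENTIONS §1)
set_option linter.dupNamespace false

noncomputable section

namespace Summit.NavierStokesRegularity.NavierStokesRegularity.Theorems.PoloidalLiouville.CentreJet.EulerTop

open MvPolynomial

/-! ### §1 Partial derivatives -/

section PDeriv

variable {σ : Type*}

/-- `∂ᵢ` lowers the weighted degree by `w i` (additive form, valid in any cancellative grading). -/
theorem isWeightedHomogeneous_pderiv {M : Type*} [AddCancelCommMonoid M] {w : σ → M}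
    {φ : MvPolynomial σ ℝ} {n : M} (i : σ) (hφ : IsWeightedHomogeneous w φ (n + w i)) :
    IsWeightedHomogeneous w (pderiv i φ) n := by
  intro m hm
  rw [coeff_pderiv] at hm
  have h := hφ (left_ne_zero_of_mul hm)
  rw [map_add, Finsupp.weight_single, one_smul] at h
  exact add_right_cancel h

/-- If `∂ᵢ q = 0` then no coefficient of `q` at an exponent `m + eᵢ` survives (characteristic zero). -/
theorem coeff_add_single_eq_zero_of_pderiv_eq_zero {q : MvPolynomial σ ℝ} {i : σ} (h : pderiv i q = 0)
    (m : σ →₀ ℕ) : coeff (m + Finsupp.single i 1) q = 0 := by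
  have hc := coeff_pderiv (i := i) q m
  rw [h, coeff_zero] at hc
  have hne : ((m i : ℝ) + 1) ≠ 0 := by positivity
  rcases mul_eq_zero.mp hc.symm with h0 | h0
  · exact h0
  · exact absurd h0 hne

/-- If `∂ᵢ q = 0` then `i` does not occur in the support of `q` (characteristic zero). -/
theorem support_apply_eq_zero_of_pderiv_eq_zero {q : MvPolynomial σ ℝ} {i : σ} (h : pderiv i q = 0)
    {d : σ →₀ ℕ} (hd : d ∈ q.support) : d i = 0 := by
  by_contra hne
  have hle : Finsupp.single i 1 ≤ d := Finsupp.single_le_iff.mpr (Nat.one_le_iff_ne_zero.mpr hne)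
  have hd' : d = (d - Finsupp.single i 1) + Finsupp.single i 1 := (tsub_add_cancel_of_le hle).symm
  rw [mem_support_iff, hd'] at hd
  exact hd (coeff_add_single_eq_zero_of_pderiv_eq_zero h _)

/-- Kernel of `∂₀` in characteristic zero: a polynomial with `∂₀ q = 0` does not involve `X 0`, i.e. it is
`rename Fin.succ H`. -/
theorem exists_rename_succ_of_pderiv_zero_eq_zero {n : ℕ} {q : MvPolynomial (Fin (n + 1)) ℝ}
    (h : pderiv 0 q = 0) : ∃ H : MvPolynomial (Fin n) ℝ, rename Fin.succ H = q := by
  classical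
  apply exists_rename_eq_of_vars_subset_range q Fin.succ (Fin.succ_injective n)
  intro i hi
  rw [Finset.mem_coe, mem_vars_iff_mem_support] at hi
  obtain ⟨d, hd, hid⟩ := hi
  have h0 : d 0 = 0 := support_apply_eq_zero_of_pderiv_eq_zero h hd
  have hi0 : i ≠ 0 := by
    rintro rfl
    rw [Finsupp.mem_support_iff] at hid
    exact hid h0
  exact ⟨i.pred hi0, Fin.succ_pred i hi0⟩

/-- Conversely `∂₀ (rename Fin.succ H) = 0`. -/
theorem pderiv_zero_rename_succ {n : ℕ} (H : MvPolynomial (Fin n) ℝ) :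
    pderiv 0 (rename Fin.succ H) = 0 := by
  classical
  apply pderiv_eq_zero_of_notMem_vars
  intro h
  have h' := vars_rename Fin.succ H h
  rw [Finset.mem_image] at h'
  obtain ⟨j, -, hj⟩ := h'
  exact Fin.succ_ne_zero j hj

end PDeriv

/-! ### §2 The parity grading of `ℝ[y₀, y₁, y₂]` by `(ZMod 2)³` -/

/-- Parity vectors. -/
abbrev Par : Type := Fin 3 → ZMod 2

/-- The parity weight: `X i` has weight `eᵢ ∈ (ZMod 2)³`. -/
def wPar : Fin 3 → Par := fun i => Pi.single i 1

/-- The all-ones parity vector `(1,1,1) = e₀ + e₁ + e₂` (the shift produced by `W·∇`). -/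
def wAll : Par := fun _ => 1

/-- `(1,1,1) = e₀ + e₁ + e₂`. -/
theorem wAll_eq : wAll = wPar 0 + wPar 1 + wPar 2 := by
  funext j
  fin_cases j <;> simp [wAll, wPar]

/-- In `(ZMod 2)³` every element is its own negative. -/
theorem par_add_self (x : Par) : x + x = 0 := by
  funext j
  exact CharTwo.add_self_eq_zero (x j)

/-- The parity weight of an exponent vector is the exponent vector mod 2. -/
theorem weight_wPar_apply (d : Fin 3 →₀ ℕ) (j : Fin 3) : Finsupp.weight wPar d j = (d j : ZMod 2) := by
  classical
  rw [Finsupp.weight_apply, Finsupp.sum, Finset.sum_apply]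
  simp only [wPar, Pi.smul_apply, Pi.single_apply, smul_ite, smul_zero, nsmul_eq_mul, mul_one]
  rw [Finset.sum_ite_eq]
  split_ifs with h
  · rfl
  · rw [Finsupp.notMem_support_iff.mp h, Nat.cast_zero]

/-- Even class: a polynomial of parity weight `0` has only even exponents, so it is `expand 2 G`. -/
theorem exists_expand_two_of_isWeightedHomogeneous_zero {P : MvPolynomial (Fin 3) ℝ}
    (hP : IsWeightedHomogeneous wPar P 0) : ∃ G : MvPolynomial (Fin 3) ℝ, expand 2 G = P := by
  classical
  have heven : ∀ d ∈ P.support, ∀ j, 2 ∣ d j := by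
    intro d hd j
    have h := congr_fun (hP (mem_support_iff.mp hd)) j
    rw [weight_wPar_apply] at h
    exact (ZMod.natCast_eq_zero_iff_even.mp h).two_dvd
  refine ⟨∑ d ∈ P.support, monomial (d.mapRange (· / 2) (by simp)) (coeff d P), ?_⟩
  rw [map_sum]
  conv_rhs => rw [P.as_sum]
  refine Finset.sum_congr rfl fun d hd => ?_
  have hd2 : 2 • d.mapRange (· / 2) (by simp) = d := by
    ext j
    rw [Finsupp.smul_apply, Finsupp.mapRange_apply, smul_eq_mul]
    exact Nat.mul_div_cancel' (heven d hd j)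
  rw [expand_monomial, hd2]

/-- Odd class in the coordinate `i₀`: every monomial carries `X i₀`, so any substitution with `X i₀ ↦ 0` kills it. -/
theorem aeval_eq_zero_of_odd {P : MvPolynomial (Fin 3) ℝ} {ε : Par} (hP : IsWeightedHomogeneous wPar P ε)
    {i₀ : Fin 3} (hε : ε i₀ ≠ 0) {A : Type*} [CommRing A] [Algebra ℝ A] (g : Fin 3 → A) (hg : g i₀ = 0) :
    aeval g P = 0 := by
  apply aeval_eq_zero
  intro d hd
  refine ⟨i₀, ?_, hg⟩
  rw [Finsupp.mem_support_iff]
  intro h0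
  have h := congr_fun (hP hd) i₀
  rw [weight_wPar_apply, h0, Nat.cast_zero] at h
  exact hε h.symm

/-- Extraction of one parity class from a sum of classes shifted by a common vector. -/
theorem weightedHomogeneousComponent_sum_shift {f : Par → MvPolynomial (Fin 3) ℝ} (s : Par)
    (hf : ∀ δ, IsWeightedHomogeneous wPar (f δ) (δ + s)) (ε : Par) :
    weightedHomogeneousComponent wPar (ε + s) (∑ δ, f δ) = f ε := by
  classical
  rw [map_sum]
  have : ∀ δ, weightedHomogeneousComponent wPar (ε + s) (f δ) = if ε = δ then f δ else 0 := by
    intro δ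
    rw [weightedHomogeneousComponent_of_mem (hf δ)]
    simp only [add_left_inj]
  simp_rw [this]
  rw [Finset.sum_ite_eq]
  simp

/-- Every polynomial is the (finite) sum of its eight parity classes. -/
theorem sum_parity_classes (T : MvPolynomial (Fin 3) ℝ) :
    ∑ ε : Par, weightedHomogeneousComponent wPar ε T = T := by
  classical
  rw [← finsum_eq_sum_of_fintype]
  exact sum_weightedHomogeneousComponent wPar T

/-! ### §3 The linear charts -/

section Chart

variable (a : Fin 3 → ℝ)

/-- `ℓ₁ = Σ uᵢ` (the polynomial `|y|²` read in the squared variables `uᵢ = yᵢ²`). -/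
def ell1 : MvPolynomial (Fin 3) ℝ := ∑ i : Fin 3, X i

/-- `ℓ₂ = Σ aᵢ uᵢ` (the polynomial `⟪y,Sy⟫` read in the squared variables). -/
def ell2 : MvPolynomial (Fin 3) ℝ := ∑ i : Fin 3, C (a i) * X i

/-- The chart `ψ : (v₀, v₁, v₂) ↦ (u₀, ℓ₁, ℓ₂)` as an algebra endomorphism of `ℝ[X₀,X₁,X₂]`. -/
def psiHom : MvPolynomial (Fin 3) ℝ →ₐ[ℝ] MvPolynomial (Fin 3) ℝ := aeval ![X 0, ell1, ell2 a]

/-- Its inverse `θ`: `u₀ = v₀`, `u₁ = (a₂(v₁ − v₀) − (v₂ − a₀v₀))/(a₂ − a₁)`, `u₂ = ((v₂ − a₀v₀) − a₁(v₁ − v₀))/(a₂ − a₁)`. -/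
def thetaHom : MvPolynomial (Fin 3) ℝ →ₐ[ℝ] MvPolynomial (Fin 3) ℝ :=
  aeval ![X 0, C (a 2 - a 1)⁻¹ * (C (a 2) * (X 1 - X 0) - (X 2 - C (a 0) * X 0)),
    C (a 2 - a 1)⁻¹ * ((X 2 - C (a 0) * X 0) - C (a 1) * (X 1 - X 0))]

/-- `ψ` fixes constants. -/
@[simp] theorem psiHom_C (r : ℝ) : psiHom a (C r) = C r := by simp [psiHom]
/-- `ψ(v₀) = u₀`. -/
@[simp] theorem psiHom_X0 : psiHom a (X 0) = X 0 := by simp [psiHom]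
/-- `ψ(v₁) = ℓ₁ = Σ uᵢ`. -/
@[simp] theorem psiHom_X1 : psiHom a (X 1) = ell1 := by simp [psiHom]
/-- `ψ(v₂) = ℓ₂ = Σ aᵢuᵢ`. -/
@[simp] theorem psiHom_X2 : psiHom a (X 2) = ell2 a := by simp [psiHom]
/-- `θ` fixes constants. -/
@[simp] theorem thetaHom_C (r : ℝ) : thetaHom a (C r) = C r := by simp [thetaHom]
/-- `θ(u₀) = v₀`. -/
@[simp] theorem thetaHom_X0 : thetaHom a (X 0) = X 0 := by simp [thetaHom]
/-- `θ(u₁) = (a₂(v₁ − v₀) − (v₂ − a₀v₀))/(a₂ − a₁)`. -/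
@[simp] theorem thetaHom_X1 :
    thetaHom a (X 1) = C (a 2 - a 1)⁻¹ * (C (a 2) * (X 1 - X 0) - (X 2 - C (a 0) * X 0)) := by simp [thetaHom]
/-- `θ(u₂) = ((v₂ − a₀v₀) − a₁(v₁ − v₀))/(a₂ − a₁)`. -/
@[simp] theorem thetaHom_X2 :
    thetaHom a (X 2) = C (a 2 - a 1)⁻¹ * ((X 2 - C (a 0) * X 0) - C (a 1) * (X 1 - X 0)) := by simp [thetaHom]

variable {a}

/-- Pairwise distinct strains give `a₂ ≠ a₁`, the only non-degeneracy the chart needs. -/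
theorem ne21_of_injective (ha : Function.Injective a) : a 2 ≠ a 1 := fun h => absurd (ha h) (by decide)

/-- The one inverse the charts need, inside the polynomial ring. -/
theorem C_inv_mul_C_sub (h : a 2 ≠ a 1) :
    C (a 2 - a 1)⁻¹ * (C (a 2) - C (a 1)) = (1 : MvPolynomial (Fin 3) ℝ) := by
  rw [← map_sub, ← map_mul, inv_mul_cancel₀ (sub_ne_zero.mpr h), map_one]

/-- `θ ∘ ψ = id` (checked on the three generators). -/
theorem thetaHom_comp_psiHom (h : a 2 ≠ a 1) : (thetaHom a).comp (psiHom a) = AlgHom.id ℝ _ := by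
  have hk := C_inv_mul_C_sub h
  refine algHom_ext fun i => ?_
  fin_cases i
  · simp
  · simp only [AlgHom.comp_apply, AlgHom.id_apply, Fin.mk_one, psiHom_X1, ell1, Fin.sum_univ_three, map_add,
      thetaHom_X0, thetaHom_X1, thetaHom_X2]
    linear_combination (X 1 - X 0) * hk
  · simp only [AlgHom.comp_apply, AlgHom.id_apply, Fin.reduceFinMk, psiHom_X2, ell2, Fin.sum_univ_three, map_add,
      map_mul, thetaHom_C, thetaHom_X0, thetaHom_X1, thetaHom_X2]
    linear_combination (X 2 - C (a 0) * X 0) * hk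

/-- `ψ ∘ θ = id` (checked on the three generators). -/
theorem psiHom_comp_thetaHom (h : a 2 ≠ a 1) : (psiHom a).comp (thetaHom a) = AlgHom.id ℝ _ := by
  have hk := C_inv_mul_C_sub h
  refine algHom_ext fun i => ?_
  fin_cases i
  · simp
  · simp only [AlgHom.comp_apply, AlgHom.id_apply, Fin.mk_one, thetaHom_X1, map_mul, map_sub, psiHom_C,
      psiHom_X0, psiHom_X1, psiHom_X2, ell1, ell2, Fin.sum_univ_three]
    linear_combination (X 1) * hk
  · simp only [AlgHom.comp_apply, AlgHom.id_apply, Fin.reduceFinMk, thetaHom_X2, map_mul, map_sub, psiHom_C,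
      psiHom_X0, psiHom_X1, psiHom_X2, ell1, ell2, Fin.sum_univ_three]
    linear_combination (X 2) * hk

/-- The chart `ψ` as an algebra automorphism (needs only `a₂ ≠ a₁`). -/
def psi (h : a 2 ≠ a 1) : MvPolynomial (Fin 3) ℝ ≃ₐ[ℝ] MvPolynomial (Fin 3) ℝ :=
  AlgEquiv.ofAlgHom (psiHom a) (thetaHom a) (psiHom_comp_thetaHom h) (thetaHom_comp_psiHom h)

/-- The equivalence `ψ` acts as the homomorphism `psiHom`. -/
@[simp] theorem psi_apply (h : a 2 ≠ a 1) (q : MvPolynomial (Fin 3) ℝ) : psi h q = psiHom a q := rfl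

/-- The composite chart `Sq = expand 2 ∘ ψ`: `v ↦ (y₀², |y|², Σ aᵢ yᵢ²)`. -/
def Sq (h : a 2 ≠ a 1) : MvPolynomial (Fin 3) ℝ →ₐ[ℝ] MvPolynomial (Fin 3) ℝ :=
  (expand 2).comp (psi h).toAlgHom

/-- `Sq q = expand 2 (ψ q)`. -/
theorem Sq_apply (h : a 2 ≠ a 1) (q : MvPolynomial (Fin 3) ℝ) : Sq h q = expand 2 (psiHom a q) := rfl

/-- `Sq(v₀) = y₀²`. -/
@[simp] theorem Sq_X0 (h : a 2 ≠ a 1) : Sq h (X 0) = X 0 ^ 2 := by simp [Sq_apply]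

/-- `Sq(v₁) = |y|² = Σ yᵢ²`. -/
@[simp] theorem Sq_X1 (h : a 2 ≠ a 1) : Sq h (X 1) = ∑ i : Fin 3, X i ^ 2 := by
  simp [Sq_apply, ell1, map_sum]

/-- `Sq(v₂) = ⟪y,Sy⟫ = Σ aᵢyᵢ²`. -/
@[simp] theorem Sq_X2 (h : a 2 ≠ a 1) : Sq h (X 2) = ∑ i : Fin 3, C (a i) * X i ^ 2 := by
  simp [Sq_apply, ell2, map_sum]

/-- The chart `Sq` is injective (`expand 2` and `ψ` are). -/
theorem Sq_injective (h : a 2 ≠ a 1) : Function.Injective (Sq h) :=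
  (expand_injective two_pos).comp (psi h).injective

/-- Every all-even polynomial is in the range of the chart `Sq`. -/
theorem exists_Sq_eq_of_isWeightedHomogeneous_zero (h : a 2 ≠ a 1) {P : MvPolynomial (Fin 3) ℝ}
    (hP : IsWeightedHomogeneous wPar P 0) : ∃ q, Sq h q = P := by
  obtain ⟨G, hG⟩ := exists_expand_two_of_isWeightedHomogeneous_zero hP
  refine ⟨(psi h).symm G, ?_⟩
  rw [Sq_apply, ← psi_apply h, AlgEquiv.apply_symm_apply, hG]

/-- On `ℝ[v₁, v₂]` (embedded by `rename Fin.succ`) the chart `ψ` is the substitution `(ℓ₁, ℓ₂)`. -/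
theorem psiHom_comp_rename_succ : (psiHom a).comp (rename Fin.succ) = aeval ![ell1, ell2 a] := by
  refine algHom_ext fun i => ?_
  fin_cases i <;> simp [psiHom]

/-- Two-variable substitutions `(v₁, v₂) ↦ (u_j + u_k, a_j u_j + a_k u_k)` with `a_j ≠ a_k` are injective
(explicit left inverse: `u_j ↦ (a_k v₁ − v₂)/(a_k − a_j)`, `u_k ↦ (v₂ − a_j v₁)/(a_k − a_j)`, the rest `↦ 0`). -/
theorem injective_of_pair {j k : Fin 3} (hjk : j ≠ k) (hajk : a k ≠ a j)
    (φ : MvPolynomial (Fin 2) ℝ →ₐ[ℝ] MvPolynomial (Fin 3) ℝ) (h0 : φ (X 0) = X j + X k)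
    (h1 : φ (X 1) = C (a j) * X j + C (a k) * X k) : Function.Injective φ := by
  classical
  let μ : MvPolynomial (Fin 3) ℝ →ₐ[ℝ] MvPolynomial (Fin 2) ℝ :=
    aeval fun l => if l = j then C (a k - a j)⁻¹ * (C (a k) * X 0 - X 1)
      else if l = k then C (a k - a j)⁻¹ * (X 1 - C (a j) * X 0) else 0
  have hμC : ∀ r : ℝ, μ (C r) = C r := fun r => by simp [μ]
  have hμj : μ (X j) = C (a k - a j)⁻¹ * (C (a k) * X 0 - X 1) := by simp [μ]
  have hμk : μ (X k) = C (a k - a j)⁻¹ * (X 1 - C (a j) * X 0) := by simp [μ, hjk.symm]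
  have hk : C (a k - a j)⁻¹ * (C (a k) - C (a j)) = (1 : MvPolynomial (Fin 2) ℝ) := by
    rw [← map_sub, ← map_mul, inv_mul_cancel₀ (sub_ne_zero.mpr hajk), map_one]
  have hcomp : μ.comp φ = AlgHom.id ℝ _ := by
    refine algHom_ext fun i => ?_
    fin_cases i
    · simp only [AlgHom.comp_apply, AlgHom.id_apply, Fin.zero_eta, h0, map_add, hμj, hμk]
      linear_combination (X 0) * hk
    · simp only [AlgHom.comp_apply, AlgHom.id_apply, Fin.mk_one, h1, map_add, map_mul, hμC, hμj, hμk]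
      linear_combination (X 1) * hk
  intro p q hpq
  have := congrArg μ hpq
  rwa [← AlgHom.comp_apply, ← AlgHom.comp_apply, hcomp] at this

end Chart

end Summit.NavierStokesRegularity.NavierStokesRegularity.Theorems.PoloidalLiouville.CentreJet.EulerTop

end
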